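import Literature.NumberTheory.EllipticCurves.PadicSigma
import Literature.NumberTheory.EllipticCurves.FormalGroupLogSummableProofs
import Literature.NumberTheory.EllipticCurves.FormalGroupDictionaryProofs
import Literature.NumberTheory.EllipticCurves.PAdicLFunctionFunctionalEquationProofs
import Literature.NumberTheory.EllipticCurves.CanonicalPAdicHeightThetaProofs
import HarnessLib

/-!
# The Mazur–Tate sigma function: the uniqueness half of MST 2006 Thm. 1.3 (proofs only)

Trunk T-NT-EC (Literature/NumberTheory/EllipticCurves). Mazur–Stein–Tate 2006, Thm. 1.3
(= Mazur–Tate 1991, Thm. 3.1) asserts that for `E/ℚ` with good ordinary reduction at `p ≥ 5`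
there is EXACTLY ONE pair `(σ, c)`, `σ = t + ⋯ ∈ tℤ_p⟦t⟧` odd, `c ∈ ℤ_p`, with
`x(t) + c = -(d/ω)((1/σ)(dσ/ω))` (the tree's named fact
`WeierstrassCurve.mazur_tate_sigma_existsUnique`, `PadicSigma.lean`). This file PROVES the formal
part of the uniqueness argument, for any `p`-integral Weierstrass equation `W/ℚ_p`:

* `WeierstrassCurve.two_mul_coeff_two_of_isFormallyOdd` — an odd (`σ(i(t)) = -σ(t)`) normalised
  `σ = t + s₁t² + ⋯` has `2s₁ = a₁` (Mazur–Tate: `σ = t + (a₁/2)t² + ⋯`);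
* `WeierstrassCurve.IsMazurTateSigmaPair.norm_sub_mul_coeff_formalLog_le` — for two Mazur–Tate
  pairs `(σ₁, c₁)`, `(σ₂, c₂)` of the same `W`, **`(c₁ - c₂) · log_W(t) ∈ ℤ_p⟦t⟧`**
  (`log_W = formalLog`, the formal logarithm): subtracting the two differential equations gives
  `D log(σ₁/σ₂) = κ - (c₁ - c₂) z`, and `D log(σ₁/σ₂) = (g₁ - g₂)/t` has integral coefficients;
* `WeierstrassCurve.IsMazurTateSigmaPair.eq_of_const_eq` — two pairs with the SAME constant `c`
  coincide (the Wronskian `s₁'s₂ - s₂'s₁` vanishes; its constant term is killed by oddness);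
* `WeierstrassCurve.IsMazurTateSigmaPair.unique_of_unbounded_formalLog`,
  `WeierstrassCurve.existsUnique_isMazurTateSigmaPair_of_exists` — hence, whenever the
  coefficients of `log_W` are `p`-adically UNBOUNDED, there is at most one Mazur–Tate pair, and
  existence alone gives `∃!`;
* `WeierstrassCurve.unbounded_formalLog_of_norm_coeff_formalOmega_eq_one` — the unboundedness
  holds as soon as the coefficients `c_{p^k}` of `ω = Σ cₙ tⁿ⁻¹ dt` are `p`-adic units
  (`coeff (p^k) log_W = c_{p^k}/p^k`), which is the ordinary case of the Atkin–Swinnerton-Dyer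
  congruences `c_{mp} ≡ a_p c_m (mod p)`;
* `WeierstrassCurve.mazur_tate_sigma_existsUnique_of` — the glue: the named fact follows from
  (a) unbounded denominators of `log` at good ordinary `p ≥ 5` and (b) the existence of a pair.

What is NOT here (and keeps `mazur_tate_sigma_existsUnique` a named fact): the arithmetic inputs
(i) `c_{p^k} ∈ ℤ_pˣ` for good ordinary reduction (Hasse invariant `≡ a_p ≡ c_p (mod p)` and the
ASD congruence, i.e. Cartier-operator theory), and (ii) the EXISTENCE of an integral pair
(Mazur–Tate 1991 §§2–3 via `p`-adic theta functions on the formal torus `Ê ≅ 𝔾̂_m` over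
`W(𝔽̄_p)`, or Katz 1973 App. 2, the unit-root splitting of `H¹_dR`).

## Sources

* B. Mazur, W. Stein, J. Tate, *Computation of `p`-adic heights and log convergence*, Doc. Math.
  Extra Vol. Coates (2006), Thm. 1.3 and Remark 1.4 ("the condition that `σ` is odd and that the
  coefficient of `t` is `1` are essential"), §3.1 (`σ_c = t·exp(∬ …)`, the constants of
  integration). [MazurSteinTate2006]
* B. Mazur, J. Tate, *The `p`-adic sigma function*, Duke Math. J. 62 (1991), Thm. 3.1
  (uniqueness among functions with bounded coefficients). [MazurTate1991]

## Design notes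

Everything is coefficient algebra in `ℚ_p⟦t⟧`; no `exp`/`log` of power series is used: the
quotient `σ₁/σ₂ = exp(κz - δz²/2)` of the informal argument is replaced by the linear identity
`ω · δ t² = h - t h'`, `h = g₁ - g₂` (difference of the two pole-cleared equations
`SatisfiesSigmaODE`), read coefficientwise, and by the Wronskian of `s₁ = σ₁/t`, `s₂ = σ₂/t`.
This file introduces no named fact.
-/

noncomputable section

open PowerSeries Literature.NumberTheory.EllipticCurves

namespace Literature.NumberTheory.EllipticCurves

variable {R : Type*} [CommRing R]

/-- `[t¹](φψ) = φ₀ψ₁ + φ₁ψ₀`. [folklore] -/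
theorem coeff_one_mul_eq (φ ψ : R⟦X⟧) :
    coeff 1 (φ * ψ) = coeff 0 φ * coeff 1 ψ + coeff 1 φ * coeff 0 ψ := by
  rw [coeff_mul, Finset.Nat.sum_antidiagonal_eq_sum_range_succ_mk, Finset.sum_range_succ,
    Finset.sum_range_succ, Finset.sum_range_zero, zero_add]

/-- `[t²](φψ) = φ₀ψ₂ + φ₁ψ₁ + φ₂ψ₀`. [folklore] -/
theorem coeff_two_mul_eq (φ ψ : R⟦X⟧) :
    coeff 2 (φ * ψ) = coeff 0 φ * coeff 2 ψ + coeff 1 φ * coeff 1 ψ + coeff 2 φ * coeff 0 ψ := by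
  rw [coeff_mul, Finset.Nat.sum_antidiagonal_eq_sum_range_succ_mk, Finset.sum_range_succ,
    Finset.sum_range_succ, Finset.sum_range_succ, Finset.sum_range_zero, zero_add]

/-- **`s(t) = σ(t)/t`** for a series `σ` without constant term: the shift
`s = Σ σₙ₊₁ tⁿ` (so `σ = t · s`, `X_mul_sigmaShift`). [Mazur–Stein–Tate 2006, §3.1
(`σ(z) = z σ₀(z)`)] [folklore] -/
def sigmaShift (σ : R⟦X⟧) : R⟦X⟧ :=
  PowerSeries.mk fun n => coeff (n + 1) σ

/-- Coefficients of the shift. [folklore] -/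
@[simp] theorem coeff_sigmaShift (σ : R⟦X⟧) (n : ℕ) :
    coeff n (sigmaShift σ) = coeff (n + 1) σ := by
  rw [sigmaShift, coeff_mk]

/-- `s(0) = σ₁` (the linear coefficient of `σ`). [folklore] -/
@[simp] theorem constantCoeff_sigmaShift (σ : R⟦X⟧) :
    constantCoeff (sigmaShift σ) = coeff 1 σ := by
  rw [← coeff_zero_eq_constantCoeff_apply, coeff_sigmaShift]

/-- `σ = t · s(t)` when `σ(0) = 0`. [folklore] -/
theorem X_mul_sigmaShift {σ : R⟦X⟧} (h : constantCoeff σ = 0) : X * sigmaShift σ = σ := by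
  conv_rhs => rw [eq_X_mul_shift_add_const σ, h, map_zero, add_zero]
  rfl

/-- `(d/dt f)(0) = f₁`. [folklore] -/
theorem constantCoeff_derivative (f : R⟦X⟧) : constantCoeff (d⁄dX R f) = coeff 1 f := by
  rw [← coeff_zero_eq_constantCoeff_apply, coeff_derivative]
  simp

end Literature.NumberTheory.EllipticCurves

namespace WeierstrassCurve

variable {R : Type*} [CommRing R] (W : WeierstrassCurve R)

/-! ### Oddness fixes the `t²`-coefficient -/

/-- `[t¹] (1 - a₁t - a₃w(t))⁻¹ = a₁` (as `w = O(t³)`). [Silverman AEC IV.1] [folklore] -/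
theorem coeff_one_invOfUnit_formalNegDenom :
    coeff 1 (invOfUnit (1 - C W.a₁ * X - C W.a₃ * W.formalW) 1) = W.a₁ := by
  set D : R⟦X⟧ := 1 - C W.a₁ * X - C W.a₃ * W.formalW with hDdef
  have hD : constantCoeff D = 1 := by simp [hDdef, W.constantCoeff_formalW]
  have hD1 : coeff 1 D = -W.a₁ := by
    simp [hDdef, coeff_C_mul, W.coeff_formalW_of_lt_three (show 1 < 3 by norm_num)]
  have hmul : D * invOfUnit D 1 = 1 := mul_invOfUnit D 1 (by rw [hD, Units.val_one])
  have h1 := congrArg (coeff 1) hmul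
  rw [coeff_one_mul_eq, coeff_zero_eq_constantCoeff_apply, hD, one_mul, hD1,
    coeff_zero_eq_constantCoeff_apply, constantCoeff_invOfUnit, inv_one, Units.val_one,
    coeff_one, if_neg one_ne_zero] at h1
  linear_combination h1

/-- **`i(t) = -t - a₁t² + O(t³)`**: the quadratic coefficient of the formal inverse.
[Silverman AEC IV.1 (`i(T) = -T - a₁T² - ⋯`)] [folklore] -/
theorem coeff_two_formalNeg : coeff 2 W.formalNeg = -W.a₁ := by
  rw [formalNeg, map_neg, show (2 : ℕ) = 1 + 1 from rfl, coeff_succ_X_mul,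
    coeff_one_invOfUnit_formalNegDenom]

/-- `[t²](i(t)²) = 1`. [folklore] -/
theorem coeff_two_formalNeg_sq : coeff 2 (W.formalNeg ^ 2) = 1 := by
  rw [pow_two, coeff_two_mul_eq, coeff_zero_eq_constantCoeff_apply, W.constantCoeff_formalNeg,
    zero_mul, zero_add, mul_zero, add_zero, coeff_one_formalNeg]
  ring

/-- **Oddness pins `σ₂`**: if `σ = t + s₁t² + ⋯` satisfies `σ(i(t)) = -σ(t)` then `2s₁ = a₁`
(comparing `t²`-coefficients: `σ(i(t)) = -t + (s₁ - a₁)t² + ⋯`). This is why MST 2006 write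
`σ = t + (a₁/2)t² + ⋯` and why oddness is "essential" (Remark 1.4): it fixes the constant of
integration `κ` in `D log σ`. [Mazur–Stein–Tate 2006, Thm. 1.3 and Rem. 1.4; Harvey 2008 §4]
[cite: MazurSteinTate2006, Rem. 1.4] -/
theorem two_mul_coeff_two_of_isFormallyOdd {σ : R⟦X⟧} (hodd : W.IsFormallyOdd σ)
    (h0 : constantCoeff σ = 0) (h1 : coeff 1 σ = 1) : 2 * coeff 2 σ = W.a₁ := by
  have h := congrArg (coeff 2) hodd
  rw [coeff_subst_eq_sum_range W.constantCoeff_formalNeg, Finset.sum_range_succ,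
    Finset.sum_range_succ, Finset.sum_range_succ, Finset.sum_range_zero, zero_add, pow_zero,
    pow_one, coeff_zero_eq_constantCoeff_apply, h0, mul_zero, zero_add, h1, mul_one,
    coeff_two_formalNeg, coeff_two_formalNeg_sq, one_mul, map_neg] at h
  linear_combination h

/-! ### The pole-cleared equation, unfolded -/

section RatAlgebra

variable {A : Type*} [CommRing A] [Algebra ℚ A] (W : WeierstrassCurve A)

/-- **`g = (s + t s')·(ω s)⁻¹ = tσ'/(ωσ) = t · D log σ`** (`s = σ/t`, `D = d/ω`), the series
through which `SatisfiesSigmaODE` clears the poles of `x + c = -D(D log σ)`.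
[Mazur–Stein–Tate 2006, Thm. 1.3; `PadicSigma.lean` module doc] [folklore] -/
def sigmaG (σ : A⟦X⟧) : A⟦X⟧ :=
  (sigmaShift σ + X * d⁄dX A (sigmaShift σ)) * invOfUnit (W.formalOmega * sigmaShift σ) 1

/-- `SatisfiesSigmaODE` is literally `ω · (t²x + c t²) = g - t g'`. [Mazur–Stein–Tate 2006,
Thm. 1.3] [folklore] -/
theorem satisfiesSigmaODE_iff (σ : A⟦X⟧) (c : A) :
    W.SatisfiesSigmaODE σ c ↔
      W.formalOmega * (W.formalXMulSq + C c * X ^ 2) = W.sigmaG σ - X * d⁄dX A (W.sigmaG σ) :=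
  Iff.rfl

/-- `(ω s)(0) = 1` for a normalised `σ = t + ⋯`. [folklore] -/
theorem constantCoeff_formalOmega_mul_sigmaShift {σ : A⟦X⟧} (h1 : coeff 1 σ = 1) :
    constantCoeff (W.formalOmega * sigmaShift σ) = 1 := by
  rw [map_mul, W.constantCoeff_formalOmega, constantCoeff_sigmaShift, h1, one_mul]

/-- `g · (ω s) = s + t s'`. [folklore] -/
theorem sigmaG_mul {σ : A⟦X⟧} (h1 : coeff 1 σ = 1) :
    W.sigmaG σ * (W.formalOmega * sigmaShift σ) = sigmaShift σ + X * d⁄dX A (sigmaShift σ) := by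
  rw [sigmaG, mul_assoc, mul_comm (invOfUnit _ _),
    mul_invOfUnit _ _ (by rw [W.constantCoeff_formalOmega_mul_sigmaShift h1, Units.val_one]),
    mul_one]

/-- `g(0) = 1`. [folklore] -/
theorem constantCoeff_sigmaG {σ : A⟦X⟧} (h1 : coeff 1 σ = 1) : constantCoeff (W.sigmaG σ) = 1 := by
  rw [sigmaG, map_mul, map_add, map_mul, constantCoeff_X, zero_mul, add_zero,
    constantCoeff_sigmaShift, h1, one_mul, constantCoeff_invOfUnit, inv_one, Units.val_one]

/-- **Difference of two pole-cleared equations**: `ω · (c₁ - c₂) t² = h - t h'` with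
`h = g₁ - g₂`. [Mazur–Tate 1991, proof of Thm. 3.1 (uniqueness)] [folklore] -/
theorem formalOmega_mul_sub_of_ode {σ₁ σ₂ : A⟦X⟧} {c₁ c₂ : A}
    (h₁ : W.SatisfiesSigmaODE σ₁ c₁) (h₂ : W.SatisfiesSigmaODE σ₂ c₂) :
    W.formalOmega * (C (c₁ - c₂) * X ^ 2) =
      (W.sigmaG σ₁ - W.sigmaG σ₂) - X * d⁄dX A (W.sigmaG σ₁ - W.sigmaG σ₂) := by
  rw [satisfiesSigmaODE_iff] at h₁ h₂
  have e : W.formalOmega * (C (c₁ - c₂) * X ^ 2) =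
      W.formalOmega * (W.formalXMulSq + C c₁ * X ^ 2) -
        W.formalOmega * (W.formalXMulSq + C c₂ * X ^ 2) := by
    rw [map_sub]; ring
  rw [e, h₁, h₂, map_sub]
  ring

end RatAlgebra

/-! ### Over `ℚ_p` -/

section Padic

variable {p : ℕ} [Fact p.Prime] (W : WeierstrassCurve ℚ_[p])

/-- `d/dt` preserves `ℤ_p⟦t⟧`. [folklore] -/
theorem _root_.Literature.NumberTheory.EllipticCurves.IsPadicInt.derivative {f : ℚ_[p]⟦X⟧}
    (hf : IsPadicInt f) : IsPadicInt (d⁄dX ℚ_[p] f) := by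
  rw [isPadicInt_iff_coeff] at hf ⊢
  intro n
  rw [coeff_derivative, norm_mul]
  have h1 : ‖((n : ℚ_[p]) + 1)‖ ≤ 1 := by
    simpa using Padic.norm_int_le_one (p := p) ((n : ℤ) + 1)
  exact mul_le_one₀ (hf _) (norm_nonneg _) h1

/-- The inverse of a series in `1 + tℤ_p⟦t⟧` lies in `ℤ_p⟦t⟧`. [folklore] -/
theorem _root_.Literature.NumberTheory.EllipticCurves.IsPadicInt.invOfUnit_one {f : ℚ_[p]⟦X⟧}
    (hf : IsPadicInt f) (h0 : constantCoeff f = 1) : IsPadicInt (invOfUnit f 1) := by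
  rw [isPadicInt_iff_exists_powerSeries_map] at hf ⊢
  obtain ⟨G, rfl⟩ := hf
  have hG : constantCoeff G = 1 := by
    have h : ((constantCoeff G : ℤ_[p]) : ℚ_[p]) = 1 := by
      rw [← h0, ← coeff_zero_eq_constantCoeff_apply, ← coeff_zero_eq_constantCoeff_apply, coeff_map]
      rfl
    exact Subtype.ext h
  exact ⟨invOfUnit G 1, map_invOfUnit_one _ G hG⟩

/-- The shift of an integral series is integral. [folklore] -/
theorem _root_.Literature.NumberTheory.EllipticCurves.IsPadicInt.sigmaShift {σ : ℚ_[p]⟦X⟧}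
    (h : IsPadicInt σ) : IsPadicInt (sigmaShift σ) := by
  rw [isPadicInt_iff_coeff] at h ⊢
  intro n
  rw [coeff_sigmaShift]
  exact h _

/-- **`g = tσ'/(ωσ) ∈ ℤ_p⟦t⟧`** for `σ ∈ t + t²ℤ_p⟦t⟧` and a `p`-integral equation (`ω ∈ ℤ_p⟦t⟧`,
`ω(0)s(0) = 1`). [Mazur–Tate 1991, Thm. 3.1 (bounded coefficients)] [folklore] -/
theorem isPadicInt_sigmaG [W.IsIntegral ℤ_[p]] {σ : ℚ_[p]⟦X⟧} (h : IsPadicInt σ)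
    (h1 : coeff 1 σ = 1) : IsPadicInt (W.sigmaG σ) :=
  (h.sigmaShift.add (IsPadicInt.powerSeries_X.mul h.sigmaShift.derivative)).mul
    ((W.isPadicInt_formalOmega.mul h.sigmaShift).invOfUnit_one
      (W.constantCoeff_formalOmega_mul_sigmaShift h1))

/-- `coeff (k+1) log_W = coeff k ω / (k+1)` (`log_W = ∫ ω`). [Silverman AEC IV.5.5] [folklore] -/
theorem coeff_succ_formalLog (k : ℕ) :
    coeff (k + 1) W.formalLog = ((k : ℚ_[p]) + 1)⁻¹ * coeff k W.formalOmega := by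
  rcases k with _ | k
  · rw [zero_add, coeff_one_formalLog, coeff_zero_eq_constantCoeff_apply,
      W.constantCoeff_formalOmega]
    norm_num
  · rw [formalLog, coeff_mk]
    dsimp only
    rw [map_div₀, map_one, map_add, map_natCast, map_ofNat, one_div]
    push_cast
    ring

/-- **The difference identity, coefficientwise**: for two solutions of the pole-cleared equation,
`(c₁ - c₂) · coeff k ω = -(k+1) · coeff (k+2) (g₁ - g₂)`. [Mazur–Tate 1991, proof of Thm. 3.1]
[folklore] -/
theorem sub_mul_coeff_formalOmega_of_ode {σ₁ σ₂ : ℚ_[p]⟦X⟧} {c₁ c₂ : ℚ_[p]}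
    (h₁ : W.SatisfiesSigmaODE σ₁ c₁) (h₂ : W.SatisfiesSigmaODE σ₂ c₂) (k : ℕ) :
    (c₁ - c₂) * coeff k W.formalOmega =
      -(((k : ℚ_[p]) + 1) * coeff (k + 2) (W.sigmaG σ₁ - W.sigmaG σ₂)) := by
  have hI := W.formalOmega_mul_sub_of_ode h₁ h₂
  have hk := congrArg (coeff (k + 2)) hI
  rw [show W.formalOmega * (C (c₁ - c₂) * X ^ 2) = (C (c₁ - c₂) * W.formalOmega) * X ^ 2 by ring,
    coeff_mul_X_pow, coeff_C_mul, map_sub, show k + 2 = (k + 1) + 1 from rfl, coeff_succ_X_mul,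
    coeff_derivative] at hk
  rw [hk]
  push_cast
  ring

/-- **`(c₁ - c₂) · coeff (k+1) log_W = -coeff (k+2) (g₁ - g₂)`**: the formal logarithm times the
difference of the constants is a difference of two `g`'s (`D log(σ₁/σ₂) = κ - (c₁ - c₂) z`).
[Mazur–Tate 1991, proof of Thm. 3.1] [folklore] -/
theorem sub_mul_coeff_formalLog_of_ode {σ₁ σ₂ : ℚ_[p]⟦X⟧} {c₁ c₂ : ℚ_[p]}
    (h₁ : W.SatisfiesSigmaODE σ₁ c₁) (h₂ : W.SatisfiesSigmaODE σ₂ c₂) (k : ℕ) :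
    (c₁ - c₂) * coeff (k + 1) W.formalLog = -coeff (k + 2) (W.sigmaG σ₁ - W.sigmaG σ₂) := by
  have hk : ((k : ℚ_[p]) + 1) ≠ 0 := Nat.cast_add_one_ne_zero k
  rw [coeff_succ_formalLog, mul_left_comm, W.sub_mul_coeff_formalOmega_of_ode h₁ h₂ k, mul_neg,
    ← mul_assoc, inv_mul_cancel₀ hk, one_mul]

namespace IsMazurTateSigmaPair

variable {W}

/-- A Mazur–Tate `σ` lies in `ℤ_p⟦t⟧`. [Mazur–Stein–Tate 2006, Thm. 1.3] [folklore] -/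
theorem isPadicInt_sigma {σ : ℚ_[p]⟦X⟧} {c : ℚ_[p]} (h : W.IsMazurTateSigmaPair σ c) :
    IsPadicInt σ :=
  isPadicInt_iff_coeff.mpr h.norm_coeff_le

/-- A Mazur–Tate `σ` is `t + (a₁/2)t² + ⋯`. [Mazur–Stein–Tate 2006, Thm. 1.3 (`σ_p(t) = t + ⋯`),
Rem. 1.4] [folklore] -/
theorem two_mul_coeff_two {σ : ℚ_[p]⟦X⟧} {c : ℚ_[p]} (h : W.IsMazurTateSigmaPair σ c) :
    2 * coeff 2 σ = W.a₁ :=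
  W.two_mul_coeff_two_of_isFormallyOdd h.odd h.constantCoeff_eq h.coeff_one_eq

/-- **`(c₁ - c₂) · log_W ∈ ℤ_p⟦t⟧`** for two Mazur–Tate pairs of a `p`-integral equation:
`‖(c₁ - c₂) · coeff m log_W‖ ≤ 1` for every `m`. [Mazur–Tate 1991, proof of Thm. 3.1
(uniqueness: `σ₁/σ₂ = exp(quadratic in z)` has bounded coefficients)] [cite: MazurSteinTate2006, Thm. 1.3] -/
theorem norm_sub_mul_coeff_formalLog_le [W.IsIntegral ℤ_[p]] {σ₁ σ₂ : ℚ_[p]⟦X⟧} {c₁ c₂ : ℚ_[p]}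
    (h₁ : W.IsMazurTateSigmaPair σ₁ c₁) (h₂ : W.IsMazurTateSigmaPair σ₂ c₂) (m : ℕ) :
    ‖(c₁ - c₂) * coeff m W.formalLog‖ ≤ 1 := by
  rcases m with _ | k
  · simp
  · rw [W.sub_mul_coeff_formalLog_of_ode h₁.ode h₂.ode k, norm_neg]
    exact isPadicInt_iff_coeff.mp ((W.isPadicInt_sigmaG h₁.isPadicInt_sigma h₁.coeff_one_eq).sub
      (W.isPadicInt_sigmaG h₂.isPadicInt_sigma h₂.coeff_one_eq)) _

/-- **The constants agree** as soon as the coefficients of `log_W` are `p`-adically unbounded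
(then `(c₁ - c₂) · log_W ∈ ℤ_p⟦t⟧` forces `c₁ = c₂`). [Mazur–Tate 1991, Thm. 3.1]
[cite: MazurSteinTate2006, Thm. 1.3] -/
theorem const_eq_of_unbounded_formalLog [W.IsIntegral ℤ_[p]]
    (hlog : ∀ N : ℕ, ∃ m, (p : ℝ) ^ N < ‖coeff m W.formalLog‖)
    {σ₁ σ₂ : ℚ_[p]⟦X⟧} {c₁ c₂ : ℚ_[p]}
    (h₁ : W.IsMazurTateSigmaPair σ₁ c₁) (h₂ : W.IsMazurTateSigmaPair σ₂ c₂) : c₁ = c₂ := by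
  by_contra hne
  have hδ : 0 < ‖c₁ - c₂‖ := norm_pos_iff.mpr (sub_ne_zero.mpr hne)
  have hp1 : (1 : ℝ) < p := by exact_mod_cast (Fact.out : p.Prime).one_lt
  obtain ⟨N, hN⟩ := pow_unbounded_of_one_lt ‖c₁ - c₂‖⁻¹ hp1
  obtain ⟨m, hm⟩ := hlog N
  have h := h₁.norm_sub_mul_coeff_formalLog_le h₂ m
  rw [norm_mul] at h
  have h2 : 1 < ‖c₁ - c₂‖ * ‖coeff m W.formalLog‖ := by
    rw [← mul_inv_cancel₀ hδ.ne']
    exact mul_lt_mul_of_pos_left (hN.trans hm) hδ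
  linarith

/-- **Two Mazur–Tate pairs with the same constant coincide.** With `c₁ = c₂` the difference
identity gives `g₁ - g₂ = κ t`; then `κ ω s₁ s₂ = s₁'s₂ - s₂'s₁` (Wronskian), whose constant term
`κ = [t²]σ₁ - [t²]σ₂` vanishes by oddness; so `(s₁/s₂)' = 0`, `s₁ = s₂`. No integrality is
used. [Mazur–Tate 1991, Thm. 3.1; Mazur–Stein–Tate 2006, §3.1 (the constants of integration)]
[cite: MazurSteinTate2006, Thm. 1.3] -/
theorem eq_of_const_eq {σ₁ σ₂ : ℚ_[p]⟦X⟧} {c : ℚ_[p]}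
    (h₁ : W.IsMazurTateSigmaPair σ₁ c) (h₂ : W.IsMazurTateSigmaPair σ₂ c) : σ₁ = σ₂ := by
  set s₁ := sigmaShift σ₁ with hs₁
  set s₂ := sigmaShift σ₂ with hs₂
  -- (1) `g₁ - g₂ = κ t`
  have hcoeff : ∀ k, coeff (k + 2) (W.sigmaG σ₁ - W.sigmaG σ₂) = 0 := fun k => by
    have e := W.sub_mul_coeff_formalOmega_of_ode h₁.ode h₂.ode k
    rw [sub_self, zero_mul, zero_eq_neg] at e
    exact (mul_eq_zero.mp e).resolve_left (Nat.cast_add_one_ne_zero k)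
  set κ : ℚ_[p] := coeff 1 (W.sigmaG σ₁ - W.sigmaG σ₂) with hκ
  have hg : W.sigmaG σ₁ = W.sigmaG σ₂ + C κ * X := by
    rw [← sub_eq_iff_eq_add']
    ext n
    rcases n with _ | _ | k
    · rw [coeff_zero_eq_constantCoeff_apply, map_sub, W.constantCoeff_sigmaG h₁.coeff_one_eq,
        W.constantCoeff_sigmaG h₂.coeff_one_eq, sub_self, coeff_zero_eq_constantCoeff_apply]
      simp
    · simp [hκ]
    · rw [hcoeff k, coeff_C_mul, coeff_X, if_neg (by omega), mul_zero]
  -- (2) the Wronskian identity `κ ω s₁ s₂ = s₁' s₂ - s₂' s₁`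
  have E1 := W.sigmaG_mul h₁.coeff_one_eq
  have E2 := W.sigmaG_mul h₂.coeff_one_eq
  rw [hg] at E1
  have hW : C κ * W.formalOmega * s₁ * s₂ = d⁄dX ℚ_[p] s₁ * s₂ - d⁄dX ℚ_[p] s₂ * s₁ := by
    apply mul_left_cancel₀ (X_ne_zero (R := ℚ_[p]))
    calc X * (C κ * W.formalOmega * s₁ * s₂)
        = (W.sigmaG σ₂ + C κ * X) * (W.formalOmega * s₁) * s₂ -
            W.sigmaG σ₂ * (W.formalOmega * s₂) * s₁ := by ring
      _ = (s₁ + X * d⁄dX ℚ_[p] s₁) * s₂ - (s₂ + X * d⁄dX ℚ_[p] s₂) * s₁ := by rw [E1, E2]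
      _ = X * (d⁄dX ℚ_[p] s₁ * s₂ - d⁄dX ℚ_[p] s₂ * s₁) := by ring
  -- (3) its constant term: `κ = [t²]σ₁ - [t²]σ₂ = 0` by oddness
  have h22 : coeff 2 σ₁ = coeff 2 σ₂ :=
    mul_left_cancel₀ (two_ne_zero' ℚ_[p]) (by rw [h₁.two_mul_coeff_two, h₂.two_mul_coeff_two])
  have hκ0 : κ = 0 := by
    have e := congrArg constantCoeff hW
    simp only [map_mul, map_sub, constantCoeff_C, W.constantCoeff_formalOmega, hs₁, hs₂,
      constantCoeff_sigmaShift, h₁.coeff_one_eq, h₂.coeff_one_eq, mul_one,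
      constantCoeff_derivative, coeff_sigmaShift, h22, sub_self] at e
    exact e
  -- (4) `s₁' s₂ = s₂' s₁`, hence `(s₁/s₂)' = 0` and `s₁ = s₂`
  rw [hκ0, map_zero, zero_mul, zero_mul, zero_mul, eq_comm, sub_eq_zero] at hW
  have hs₂0 : constantCoeff s₂ = 1 := by rw [hs₂, constantCoeff_sigmaShift, h₂.coeff_one_eq]
  have hv : s₂ * invOfUnit s₂ 1 = 1 := mul_invOfUnit s₂ 1 (by rw [hs₂0, Units.val_one])
  set v := invOfUnit s₂ 1 with hvdef
  have hdv : s₂ * d⁄dX ℚ_[p] v + v * d⁄dX ℚ_[p] s₂ = 0 := by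
    have e := congrArg (d⁄dX ℚ_[p]) hv
    rwa [Derivation.leibniz, smul_eq_mul, smul_eq_mul, Derivation.map_one_eq_zero] at e
  have hdu : d⁄dX ℚ_[p] (s₁ * v) = 0 := by
    have hs₂ne : s₂ ≠ 0 := fun h0 => by rw [h0, map_zero] at hs₂0; exact zero_ne_one hs₂0
    refine (mul_eq_zero.mp ?_).resolve_left hs₂ne
    calc s₂ * d⁄dX ℚ_[p] (s₁ * v)
        = v * (d⁄dX ℚ_[p] s₁ * s₂ - d⁄dX ℚ_[p] s₂ * s₁) +
            s₁ * (s₂ * d⁄dX ℚ_[p] v + v * d⁄dX ℚ_[p] s₂) := by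
          rw [Derivation.leibniz, smul_eq_mul, smul_eq_mul]; ring
      _ = 0 := by rw [hW, hdv, sub_self, mul_zero, mul_zero, add_zero]
  have hu : s₁ * v = 1 := by
    ext n
    rcases n with _ | n
    · rw [coeff_zero_eq_constantCoeff_apply, coeff_zero_eq_constantCoeff_apply, map_mul, map_one,
        hs₁, constantCoeff_sigmaShift, h₁.coeff_one_eq, one_mul, hvdef, constantCoeff_invOfUnit,
        inv_one, Units.val_one]
    · have e := congrArg (coeff n) hdu
      rw [coeff_derivative, map_zero] at e
      rw [coeff_one, if_neg (Nat.succ_ne_zero n)]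
      exact (mul_eq_zero.mp e).resolve_right (Nat.cast_add_one_ne_zero n)
  have hss : s₁ = s₂ := by
    calc s₁ = s₁ * (s₂ * v) := by rw [hv, mul_one]
      _ = (s₁ * v) * s₂ := by ring
      _ = s₂ := by rw [hu, one_mul]
  rw [← X_mul_sigmaShift h₁.constantCoeff_eq, ← X_mul_sigmaShift h₂.constantCoeff_eq, ← hs₁, ← hs₂,
    hss]

/-- **Uniqueness of the Mazur–Tate pair, given unbounded denominators of `log_W`.** For a
`p`-integral `W/ℚ_p` whose formal logarithm has `p`-adically unbounded coefficients, any two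
Mazur–Tate pairs coincide. (For good ORDINARY reduction the hypothesis holds:
`coeff (p^k) log_W = c_{p^k}/p^k` with `c_{p^k} ∈ ℤ_pˣ`; see
`unbounded_formalLog_of_norm_coeff_formalOmega_eq_one`.) [Mazur–Tate 1991, Thm. 3.1;
Mazur–Stein–Tate 2006, Thm. 1.3 ("exactly one")] [cite: MazurSteinTate2006, Thm. 1.3] -/
theorem unique_of_unbounded_formalLog [W.IsIntegral ℤ_[p]]
    (hlog : ∀ N : ℕ, ∃ m, (p : ℝ) ^ N < ‖coeff m W.formalLog‖)
    {σ₁ σ₂ : ℚ_[p]⟦X⟧} {c₁ c₂ : ℚ_[p]}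
    (h₁ : W.IsMazurTateSigmaPair σ₁ c₁) (h₂ : W.IsMazurTateSigmaPair σ₂ c₂) :
    σ₁ = σ₂ ∧ c₁ = c₂ := by
  obtain rfl := h₁.const_eq_of_unbounded_formalLog hlog h₂
  exact ⟨h₁.eq_of_const_eq h₂, rfl⟩

end IsMazurTateSigmaPair

/-- **Existence alone gives `∃!`** (under unbounded denominators of `log_W`): the shape in which
`mazur_tate_sigma_existsUnique` quantifies. [Mazur–Stein–Tate 2006, Thm. 1.3]
[cite: MazurSteinTate2006, Thm. 1.3] -/
theorem existsUnique_isMazurTateSigmaPair_of_exists [W.IsIntegral ℤ_[p]]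
    (hlog : ∀ N : ℕ, ∃ m, (p : ℝ) ^ N < ‖coeff m W.formalLog‖)
    (hex : ∃ σ : ℚ_[p]⟦X⟧, ∃ c, W.IsMazurTateSigmaPair σ c) :
    ∃! σc : ℚ_[p]⟦X⟧ × ℚ_[p], W.IsMazurTateSigmaPair σc.1 σc.2 := by
  obtain ⟨σ, c, h⟩ := hex
  refine ⟨(σ, c), h, fun σc h' => ?_⟩
  obtain ⟨e1, e2⟩ := h'.unique_of_unbounded_formalLog hlog h
  exact Prod.ext e1 e2

/-- **Unit coefficients `c_{p^k}` make `log_W` unbounded**: if `‖c_{p^{k+1}}‖ = 1` for all `k`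
(`ω = Σ cₙ tⁿ⁻¹ dt`; the ordinary case of the Atkin–Swinnerton-Dyer congruences), then
`‖coeff (p^{k+1}) log_W‖ = p^{k+1}` is unbounded. [Silverman AEC IV.5.5 (`log = Σ cₙtⁿ/n`)]
[folklore] -/
theorem unbounded_formalLog_of_norm_coeff_formalOmega_eq_one
    (hunit : ∀ k : ℕ, ‖coeff (p ^ (k + 1) - 1) W.formalOmega‖ = 1) :
    ∀ N : ℕ, ∃ m, (p : ℝ) ^ N < ‖coeff m W.formalLog‖ := by
  intro N
  have hp : p.Prime := Fact.out
  have hp1 : (1 : ℝ) < p := by exact_mod_cast hp.one_lt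
  have hnat : p ^ (N + 1) - 1 + 1 = p ^ (N + 1) := Nat.sub_add_cancel (Nat.one_le_pow _ _ hp.pos)
  refine ⟨p ^ (N + 1), ?_⟩
  rw [← hnat, coeff_succ_formalLog, norm_mul, hunit, mul_one, norm_inv]
  have hcast : ((p ^ (N + 1) - 1 : ℕ) : ℚ_[p]) + 1 = (p : ℚ_[p]) ^ (N + 1) := by
    exact_mod_cast hnat
  rw [hcast, norm_pow, Padic.norm_p, inv_pow, inv_inv]
  exact pow_lt_pow_right₀ hp1 (Nat.lt_succ_self N)

end Padic

/-- **Glue for the named fact.** `mazur_tate_sigma_existsUnique` (MST 2006 Thm. 1.3) follows from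
its two arithmetic halves: (a) for `W/ℚ` globally minimal and `p ≥ 5` good ordinary, the formal
logarithm of `W ⊗ ℚ_p` has `p`-adically unbounded coefficients (finite height / ASD congruences),
and (b) a Mazur–Tate pair EXISTS (Mazur–Tate 1991 §§2–3; Katz 1973 App. 2). The `p`-integrality
of `W ⊗ ℚ_p` is the tree's instance chain `IsGloballyMinimal.isIntegral_int`,
`isIntegral_padicInt_baseChange`. [Mazur–Stein–Tate 2006, Thm. 1.3]
[cite: MazurSteinTate2006, Thm. 1.3] -/
theorem mazur_tate_sigma_existsUnique_of
    (hlog : ∀ (W : WeierstrassCurve ℚ) [W.IsElliptic] [W.IsGloballyMinimal] (p : ℕ) [Fact p.Prime],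
      5 ≤ p → W.HasGoodReductionAtPrime p → ¬ (p : ℤ) ∣ W.frobeniusTrace p →
        ∀ N : ℕ, ∃ m, (p : ℝ) ^ N < ‖coeff m (W.baseChange ℚ_[p]).formalLog‖)
    (hex : ∀ (W : WeierstrassCurve ℚ) [W.IsElliptic] [W.IsGloballyMinimal] (p : ℕ) [Fact p.Prime],
      5 ≤ p → W.HasGoodReductionAtPrime p → ¬ (p : ℤ) ∣ W.frobeniusTrace p →
        ∃ σ : ℚ_[p]⟦X⟧, ∃ c, (W.baseChange ℚ_[p]).IsMazurTateSigmaPair σ c) :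
    mazur_tate_sigma_existsUnique := by
  intro W _ _ p _ hp hgood hord
  exact (W.baseChange ℚ_[p]).existsUnique_isMazurTateSigmaPair_of_exists (hlog W p hp hgood hord)
    (hex W p hp hgood hord)

end WeierstrassCurve
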